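import Literature.AnabelianGeometry.SemiGraphs.ApproximatorGluedCoverings
import Literature.AnabelianGeometry.SemiGraphs.CoveringProducts
import HarnessLib

/-!
# [SemiAnbd] §2–§3: coverings glued over a base covering (the construction of the proof of
# Proposition 2.6 run in a covering `G' → G`, as in the proof of Corollary 2.7 (i))

Mochizuki, *Semi-graphs of anabelioids*, Publ. RIMS **42** (2006), §2, manuscript pp. 28–30
[cite: MochizukiSemiAnbd2006, Cor 2.7 p.30]: Corollary 2.7 (i) — and through it the same-vertex
case of Theorem 3.7 (ii) — is proved by passing to a covering `G' → G` in which two conjugates of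
`Π_v` become the groups of DISTINCT vertices of `G'` and gluing the covering `G''` of p. 28 over `G'`
with the `Π'_v/N`-part over one of them only.  In the local presentation (`TemperedCoverings.lean`) a
covering of `G'` is an object of `B^cov(G)` over the object `S₀` attached to `G'`, the vertices of
`G'` over `w` being the `Π_w`-orbits of `(S₀)_w`.  `Approximator.RelGluingData A S₀` = absolute
gluing data `D` (`ApproximatorGluedCoverings.lean`; fibres off the distinguished locus) + a second
family of vertex fibres `X^O_w` (over the distinguished `Π_w`-invariant subsets `O_w ⊆ (S₀)_w`),
free over the edge groups and of matching cardinality; `RelGluingData.cov` = the object of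
`B^cov(G)` with `w`-constituent `(O_w × X^O_w) ⊔ ((S₀)_w ∖ O_w × X_w)` and `e`-constituent
`(S₀)_e × X_e` (diagonal actions, `Π_c → Π'_c` on the fibres), glued along the gluings of `S₀` and
of the fibres; it is TEMPERED when `S₀` is (`cov_isTempered`: split by `F₀ × trivCov`).
Plain bookkeeping; no statement of the paper is involved.
-/

open CategoryTheory Topology

namespace Literature.AnabelianGeometry.SemiGraphs

universe u

section Tools

open scoped Pointwise

/-- A homomorphism with open kernel to a discrete group pulls every subset back to an open set.
[folklore] -/
private theorem isOpen_preimage_of_isOpen_ker' {G : Type u} [Group G] [TopologicalSpace G]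
    [IsTopologicalGroup G] {F : Type*} [Group F] (π : G →* F)
    (hπ : IsOpen (π.ker : Set G)) (S : Set F) : IsOpen (π ⁻¹' S) := by
  have : π ⁻¹' S = (π ⁻¹' S) * (π.ker : Set G) := by
    ext x
    constructor
    · intro hx
      exact ⟨x, hx, 1, π.ker.one_mem, mul_one x⟩
    · rintro ⟨a, ha, k, hk, rfl⟩
      simp only [Set.mem_preimage, map_mul, (MonoidHom.mem_ker).mp hk, mul_one]
      exact ha
  rw [this]
  exact hπ.mul_left

end Tools

namespace ProfiniteSemiGraph

variable {𝒢 : ProfiniteSemiGraph.{u}}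

namespace Approximator

variable (A : 𝒢.Approximator) (S₀ : CovObj 𝒢)

/-- **Relative gluing data** over an approximator `G → G'` and a base covering `S₀`: absolute
gluing data `D` (edge fibres `X_e`, vertex fibres `X_w` used OFF the distinguished locus), a second
family `X^O_w` of finite `Π'_w`-sets used OVER the distinguished `Π_w`-invariant subsets
`O_w ⊆ (S₀)_w`, free under the conjugates of the branch images and of the same cardinality as the
edge fibres (pp. 28, 30). [cite: MochizukiSemiAnbd2006, Cor 2.7 p.30] -/
structure RelGluingData : Type (u + 1) where
  /-- the absolute gluing data (edge fibres; vertex fibres off `O`) -/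
  D : A.GluingData
  /-- the vertex fibres over `O` -/
  XO : 𝒢.graph.Vertex → Type u
  [actO : ∀ w, MulAction (A.FV w) (XO w)]
  [finiteO : ∀ w, Finite (XO w)]
  /-- the fibres over `O` are free under the conjugates of the branch images -/
  free_O : ∀ (b : 𝒢.graph.Branch) (w : 𝒢.graph.Vertex) (h : 𝒢.graph.abuts b = some w)
    (g : A.FV w) (f : A.FE (𝒢.graph.edgeOf b)) (x : XO w),
    (g * A.brF b w h f * g⁻¹) • x = x → f = 1
  /-- matching cardinalities along the branches -/
  card_O : ∀ (b : 𝒢.graph.Branch) (w : 𝒢.graph.Vertex), 𝒢.graph.abuts b = some w →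
    Nat.card (D.XE (𝒢.graph.edgeOf b)) = Nat.card (XO w)
  /-- the distinguished subsets of the vertex fibres of the base -/
  O : ∀ w : 𝒢.graph.Vertex, Set ((S₀.SV w).obj.V)
  /-- … which are `Π_w`-invariant -/
  O_inv : ∀ (w : 𝒢.graph.Vertex) (γ : 𝒢.Gv w) (y : (S₀.SV w).obj.V),
    (S₀.SV w).obj.ρ γ y ∈ O w ↔ y ∈ O w

namespace RelGluingData

attribute [instance] RelGluingData.actO RelGluingData.finiteO

variable {A S₀} (R : A.RelGluingData S₀)

/-- The gluing data "over `O`": the fibres `X^O_w` with the edge fibres of `D`.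
[cite: MochizukiSemiAnbd2006, Cor 2.7 p.30] -/
def DO : A.GluingData where
  XV := R.XO
  XE := R.D.XE
  free_E := R.D.free_E
  free_br := R.free_O
  card_br := R.card_O

/-- The carrier of the `w`-constituent: `(O_w × X^O_w) ⊔ ((S₀)_w ∖ O_w × X_w)`.
[cite: MochizukiSemiAnbd2006, Cor 2.7 p.30] -/
abbrev VTy (w : 𝒢.graph.Vertex) : Type u :=
  {y : (S₀.SV w).obj.V // y ∈ R.O w} × R.XO w ⊕ {y : (S₀.SV w).obj.V // y ∉ R.O w} × R.D.XV w

/-- The diagonal action of `Π_w` on the `w`-constituent (through `Π_w → Π'_w` on the fibres).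
[cite: MochizukiSemiAnbd2006, Cor 2.7 p.30] -/
@[reducible] noncomputable def actionV (w : 𝒢.graph.Vertex) : MulAction (𝒢.Gv w) (R.VTy w) where
  smul γ := Sum.map
    (fun p : {y : (S₀.SV w).obj.V // y ∈ R.O w} × R.XO w =>
      ((⟨(S₀.SV w).obj.ρ γ p.1.1, (R.O_inv w γ p.1.1).mpr p.1.2⟩ :
        {y : (S₀.SV w).obj.V // y ∈ R.O w}), A.πV w γ • p.2))
    (fun p : {y : (S₀.SV w).obj.V // y ∉ R.O w} × R.D.XV w =>
      ((⟨(S₀.SV w).obj.ρ γ p.1.1, fun h => p.1.2 ((R.O_inv w γ p.1.1).mp h)⟩ :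
        {y : (S₀.SV w).obj.V // y ∉ R.O w}), A.πV w γ • p.2))
  one_smul x := by
    rcases x with ⟨⟨y, hy⟩, z⟩ | ⟨⟨y, hy⟩, z⟩
    · change (Sum.inl ((⟨(S₀.SV w).obj.ρ 1 y, _⟩ : {y : (S₀.SV w).obj.V // y ∈ R.O w}), A.πV w 1 • z) : R.VTy w) = _
      congr 2
      · exact Subtype.ext (show (S₀.SV w).obj.ρ 1 y = y by rw [map_one]; rfl)
      · rw [map_one, one_smul]
    · change (Sum.inr ((⟨(S₀.SV w).obj.ρ 1 y, _⟩ : {y : (S₀.SV w).obj.V // y ∉ R.O w}), A.πV w 1 • z) : R.VTy w) = _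
      congr 2
      · exact Subtype.ext (show (S₀.SV w).obj.ρ 1 y = y by rw [map_one]; rfl)
      · rw [map_one, one_smul]
  mul_smul γ γ' x := by
    rcases x with ⟨⟨y, hy⟩, z⟩ | ⟨⟨y, hy⟩, z⟩
    · change (Sum.inl ((⟨(S₀.SV w).obj.ρ (γ * γ') y, _⟩ : {y : (S₀.SV w).obj.V // y ∈ R.O w}), A.πV w (γ * γ') • z) :
          R.VTy w) =
        Sum.inl ((⟨(S₀.SV w).obj.ρ γ ((S₀.SV w).obj.ρ γ' y), _⟩ : {y : (S₀.SV w).obj.V // y ∈ R.O w}), A.πV w γ • A.πV w γ' • z)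
      congr 2
      · exact Subtype.ext (show (S₀.SV w).obj.ρ (γ * γ') y =
          (S₀.SV w).obj.ρ γ ((S₀.SV w).obj.ρ γ' y) by rw [map_mul]; rfl)
      · rw [map_mul, mul_smul]
    · change (Sum.inr ((⟨(S₀.SV w).obj.ρ (γ * γ') y, _⟩ : {y : (S₀.SV w).obj.V // y ∉ R.O w}), A.πV w (γ * γ') • z) :
          R.VTy w) =
        Sum.inr ((⟨(S₀.SV w).obj.ρ γ ((S₀.SV w).obj.ρ γ' y), _⟩ : {y : (S₀.SV w).obj.V // y ∉ R.O w}), A.πV w γ • A.πV w γ' • z)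
      congr 2
      · exact Subtype.ext (show (S₀.SV w).obj.ρ (γ * γ') y =
          (S₀.SV w).obj.ρ γ ((S₀.SV w).obj.ρ γ' y) by rw [map_mul]; rfl)
      · rw [map_mul, mul_smul]

/-- The `w`-constituent of the relatively glued covering: countable, open stabilisers.
[cite: MochizukiSemiAnbd2006, Cor 2.7 p.30] -/
noncomputable def objV (w : 𝒢.graph.Vertex) : BTemp (𝒢.Gv w) :=
  ⟨@Action.ofMulAction (𝒢.Gv w) (R.VTy w) _ (R.actionV w), by
    haveI : Countable (S₀.SV w).obj.V := (S₀.SV w).property.1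
    refine ⟨inferInstanceAs (Countable (R.VTy w)), fun x => ?_⟩
    change R.VTy w at x
    rcases x with ⟨⟨y, hy⟩, z⟩ | ⟨⟨y, hy⟩, z⟩
    · have : {γ : 𝒢.Gv w | (@Action.ofMulAction (𝒢.Gv w) (R.VTy w) _ (R.actionV w)).ρ γ
          (Sum.inl (⟨y, hy⟩, z) : R.VTy w) = (Sum.inl (⟨y, hy⟩, z) : R.VTy w)} =
          {γ | (S₀.SV w).obj.ρ γ y = y} ∩ A.πV w ⁻¹' {f | f • z = z} := by
        ext γ
        simp only [Set.mem_setOf_eq, Set.mem_inter_iff, Set.mem_preimage]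
        change (Sum.inl ((⟨(S₀.SV w).obj.ρ γ y, _⟩ : {y : (S₀.SV w).obj.V // y ∈ R.O w}), A.πV w γ • z) : R.VTy w) =
          Sum.inl (⟨y, hy⟩, z) ↔ _
        rw [Sum.inl.injEq, Prod.mk.injEq, Subtype.mk.injEq]
      rw [this]
      exact ((S₀.SV w).property.2 y).inter
        (isOpen_preimage_of_isOpen_ker' (A.πV w) (A.isOpen_ker_πV w) _)
    · have : {γ : 𝒢.Gv w | (@Action.ofMulAction (𝒢.Gv w) (R.VTy w) _ (R.actionV w)).ρ γ
          (Sum.inr (⟨y, hy⟩, z) : R.VTy w) = (Sum.inr (⟨y, hy⟩, z) : R.VTy w)} =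
          {γ | (S₀.SV w).obj.ρ γ y = y} ∩ A.πV w ⁻¹' {f | f • z = z} := by
        ext γ
        simp only [Set.mem_setOf_eq, Set.mem_inter_iff, Set.mem_preimage]
        change (Sum.inr ((⟨(S₀.SV w).obj.ρ γ y, _⟩ : {y : (S₀.SV w).obj.V // y ∉ R.O w}), A.πV w γ • z) : R.VTy w) =
          Sum.inr (⟨y, hy⟩, z) ↔ _
        rw [Sum.inr.injEq, Prod.mk.injEq, Subtype.mk.injEq]
      rw [this]
      exact ((S₀.SV w).property.2 y).inter
        (isOpen_preimage_of_isOpen_ker' (A.πV w) (A.isOpen_ker_πV w) _)⟩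

/-- The `e`-constituent: `(S₀)_e × X_e` with the diagonal action.
[cite: MochizukiSemiAnbd2006, Cor 2.7 p.30] -/
noncomputable def objE (e : 𝒢.graph.Edge) : BTemp (𝒢.Ge e) := BTemp.prodObj (S₀.SE e) (R.D.objE e)

/-- The action on the `w`-constituent over `O`, unfolded. [cite: MochizukiSemiAnbd2006, Cor 2.7 p.30] -/
theorem objV_ρ_inl (w : 𝒢.graph.Vertex) (γ : 𝒢.Gv w) (y : (S₀.SV w).obj.V) (hy : y ∈ R.O w)
    (z : R.XO w) :
    (R.objV w).obj.ρ γ (Sum.inl (⟨y, hy⟩, z) : R.VTy w) =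
      (Sum.inl (⟨(S₀.SV w).obj.ρ γ y, (R.O_inv w γ y).mpr hy⟩, A.πV w γ • z) : R.VTy w) :=
  rfl

/-- The action on the `w`-constituent off `O`, unfolded. [cite: MochizukiSemiAnbd2006, Cor 2.7 p.30] -/
theorem objV_ρ_inr (w : 𝒢.graph.Vertex) (γ : 𝒢.Gv w) (y : (S₀.SV w).obj.V) (hy : y ∉ R.O w)
    (z : R.D.XV w) :
    (R.objV w).obj.ρ γ (Sum.inr (⟨y, hy⟩, z) : R.VTy w) =
      (Sum.inr (⟨(S₀.SV w).obj.ρ γ y, fun h => hy ((R.O_inv w γ y).mp h)⟩, A.πV w γ • z) :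
        R.VTy w) :=
  rfl

/-- The action on the `e`-constituent, unfolded. [cite: MochizukiSemiAnbd2006, Cor 2.7 p.30] -/
theorem objE_ρ (e : 𝒢.graph.Edge) (γ : 𝒢.Ge e) (u : (S₀.SE e).obj.V) (z : R.D.XE e) :
    (R.objE e).obj.ρ γ ((u, z) : (S₀.SE e).obj.V × R.D.XE e) =
      (((S₀.SE e).obj.ρ γ u, A.πE e γ • z) : (S₀.SE e).obj.V × R.D.XE e) :=
  rfl

section Glue

variable (b : 𝒢.graph.Branch) (w : 𝒢.graph.Vertex) (h : 𝒢.graph.abuts b = some w)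

open Classical in
/-- The gluing map along `b`: `(u, z) ↦ (glue₀ u, ε(z))`, with the fibre isomorphism chosen over
`O` or off `O` according to the position of `glue₀ u`. [cite: MochizukiSemiAnbd2006, Cor 2.7 p.30] -/
noncomputable def glueFun (εO : R.D.XE (𝒢.graph.edgeOf b) ≃ R.XO w)
    (ε : R.D.XE (𝒢.graph.edgeOf b) ≃ R.D.XV w) :
    (S₀.SE (𝒢.graph.edgeOf b)).obj.V × R.D.XE (𝒢.graph.edgeOf b) → R.VTy w := fun p =>
  if hy : BTemp.equivOfIso (S₀.glue b w h) p.1 ∈ R.O w then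
    Sum.inl ((⟨BTemp.equivOfIso (S₀.glue b w h) p.1, hy⟩ : {y : (S₀.SV w).obj.V // y ∈ R.O w}),
      εO p.2)
  else
    Sum.inr ((⟨BTemp.equivOfIso (S₀.glue b w h) p.1, hy⟩ : {y : (S₀.SV w).obj.V // y ∉ R.O w}),
      ε p.2)

/-- Its inverse. [cite: MochizukiSemiAnbd2006, Cor 2.7 p.30] -/
noncomputable def glueInv (εO : R.D.XE (𝒢.graph.edgeOf b) ≃ R.XO w)
    (ε : R.D.XE (𝒢.graph.edgeOf b) ≃ R.D.XV w) :
    R.VTy w → (S₀.SE (𝒢.graph.edgeOf b)).obj.V × R.D.XE (𝒢.graph.edgeOf b) :=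
  Sum.elim (fun p => ((BTemp.equivOfIso (S₀.glue b w h)).symm p.1.1, εO.symm p.2))
    (fun p => ((BTemp.equivOfIso (S₀.glue b w h)).symm p.1.1, ε.symm p.2))

/-- The gluing map is a bijection. [cite: MochizukiSemiAnbd2006, Cor 2.7 p.30] -/
noncomputable def glueEquiv (εO : R.D.XE (𝒢.graph.edgeOf b) ≃ R.XO w)
    (ε : R.D.XE (𝒢.graph.edgeOf b) ≃ R.D.XV w) :
    (S₀.SE (𝒢.graph.edgeOf b)).obj.V × R.D.XE (𝒢.graph.edgeOf b) ≃ R.VTy w where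
  toFun := R.glueFun b w h εO ε
  invFun := R.glueInv b w h εO ε
  left_inv p := by
    obtain ⟨u, z⟩ := p
    unfold glueFun
    by_cases hy : BTemp.equivOfIso (S₀.glue b w h) u ∈ R.O w
    · rw [dif_pos hy]
      exact Prod.ext (Equiv.symm_apply_apply _ _) (Equiv.symm_apply_apply _ _)
    · rw [dif_neg hy]
      exact Prod.ext (Equiv.symm_apply_apply _ _) (Equiv.symm_apply_apply _ _)
  right_inv x := by
    rcases x with ⟨⟨y, hy⟩, z⟩ | ⟨⟨y, hy⟩, z⟩
    · have hy' : BTemp.equivOfIso (S₀.glue b w h)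
          ((BTemp.equivOfIso (S₀.glue b w h)).symm y) ∈ R.O w := by
        rwa [Equiv.apply_symm_apply]
      change R.glueFun b w h εO ε ((BTemp.equivOfIso (S₀.glue b w h)).symm y, εO.symm z) = _
      unfold glueFun
      rw [dif_pos hy']
      exact congrArg Sum.inl (Prod.ext (Subtype.ext (Equiv.apply_symm_apply _ _))
        (Equiv.apply_symm_apply _ _))
    · have hy' : BTemp.equivOfIso (S₀.glue b w h)
          ((BTemp.equivOfIso (S₀.glue b w h)).symm y) ∉ R.O w := by
        rwa [Equiv.apply_symm_apply]
      change R.glueFun b w h εO ε ((BTemp.equivOfIso (S₀.glue b w h)).symm y, ε.symm z) = _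
      unfold glueFun
      rw [dif_neg hy']
      exact congrArg Sum.inr (Prod.ext (Subtype.ext (Equiv.apply_symm_apply _ _))
        (Equiv.apply_symm_apply _ _))

/-- The projection of the gluing map is the gluing of the base. [cite: MochizukiSemiAnbd2006, Cor 2.7 p.30] -/
theorem glueFun_fst (εO : R.D.XE (𝒢.graph.edgeOf b) ≃ R.XO w)
    (ε : R.D.XE (𝒢.graph.edgeOf b) ≃ R.D.XV w)
    (p : (S₀.SE (𝒢.graph.edgeOf b)).obj.V × R.D.XE (𝒢.graph.edgeOf b)) :
    Sum.elim (fun q => q.1.1) (fun q => q.1.1) (R.glueFun b w h εO ε p) =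
      (S₀.glue b w h).hom.hom.hom p.1 := by
  unfold glueFun
  by_cases hy : BTemp.equivOfIso (S₀.glue b w h) p.1 ∈ R.O w
  · rw [dif_pos hy]
    rfl
  · rw [dif_neg hy]
    rfl

/-- There is a gluing isomorphism along `b` (both fibre families being free `Π'_e`-sets of the
cardinality of `X_e`, twisted by the 2-cell of the approximator), whose first component is the
gluing of the base. [cite: MochizukiSemiAnbd2006, Cor 2.7 p.30] -/
theorem exists_glueEquiv :
    ∃ Φ : (R.objE (𝒢.graph.edgeOf b)).obj.V ≃ ((BTemp.res (𝒢.brHom b w h)).obj (R.objV w)).obj.V,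
      (∀ (x : 𝒢.Ge (𝒢.graph.edgeOf b)) (p : (R.objE (𝒢.graph.edgeOf b)).obj.V),
        Φ ((R.objE (𝒢.graph.edgeOf b)).obj.ρ x p) =
          ((BTemp.res (𝒢.brHom b w h)).obj (R.objV w)).obj.ρ x (Φ p)) ∧
      ∀ p : (S₀.SE (𝒢.graph.edgeOf b)).obj.V × R.D.XE (𝒢.graph.edgeOf b),
        Sum.elim (fun q => q.1.1) (fun q => q.1.1) (Φ p) = (S₀.glue b w h).hom.hom.hom p.1 := by
  classical
  obtain ⟨εO, hεO⟩ := R.DO.exists_glueEquiv b w h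
  obtain ⟨ε, hε⟩ := R.D.exists_glueEquiv b w h
  let εO' : R.D.XE (𝒢.graph.edgeOf b) ≃ R.XO w := εO
  let ε' : R.D.XE (𝒢.graph.edgeOf b) ≃ R.D.XV w := ε
  have hO : ∀ (x : 𝒢.Ge (𝒢.graph.edgeOf b)) (z : R.D.XE (𝒢.graph.edgeOf b)),
      εO' (A.πE _ x • z) = A.πV w (𝒢.brHom b w h x) • εO' z := hεO
  have hD : ∀ (x : 𝒢.Ge (𝒢.graph.edgeOf b)) (z : R.D.XE (𝒢.graph.edgeOf b)),
      ε' (A.πE _ x • z) = A.πV w (𝒢.brHom b w h x) • ε' z := hε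
  refine ⟨R.glueEquiv b w h εO' ε', fun x p => ?_, fun p => R.glueFun_fst b w h εO' ε' p⟩
  obtain ⟨u, z⟩ := p
  change R.D.XE (𝒢.graph.edgeOf b) at z
  have h0 : BTemp.equivOfIso (S₀.glue b w h) ((S₀.SE _).obj.ρ x u) =
      (S₀.SV w).obj.ρ (𝒢.brHom b w h x) (BTemp.equivOfIso (S₀.glue b w h) u) :=
    BTemp.equivOfIso_ρ (S₀.glue b w h) x u
  change R.glueFun b w h εO' ε' ((S₀.SE _).obj.ρ x u, A.πE _ x • z) =
    (R.objV w).obj.ρ (𝒢.brHom b w h x) (R.glueFun b w h εO' ε' (u, z))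
  unfold glueFun
  dsimp only
  by_cases hy : BTemp.equivOfIso (S₀.glue b w h) u ∈ R.O w
  · have hy' : BTemp.equivOfIso (S₀.glue b w h) ((S₀.SE _).obj.ρ x u) ∈ R.O w := by
      rw [h0]; exact (R.O_inv w _ _).mpr hy
    rw [dif_pos hy', dif_pos hy, objV_ρ_inl]
    exact congrArg Sum.inl (Prod.ext (Subtype.ext h0) (hO x z))
  · have hy' : BTemp.equivOfIso (S₀.glue b w h) ((S₀.SE _).obj.ρ x u) ∉ R.O w := by
      rw [h0]; exact fun h' => hy ((R.O_inv w _ _).mp h')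
    rw [dif_neg hy', dif_neg hy, objV_ρ_inr]
    exact congrArg Sum.inr (Prod.ext (Subtype.ext h0) (hD x z))

/-- A chosen gluing isomorphism along `b`. [cite: MochizukiSemiAnbd2006, Cor 2.7 p.30] -/
noncomputable def glue :
    R.objE (𝒢.graph.edgeOf b) ≅ (BTemp.res (𝒢.brHom b w h)).obj (R.objV w) :=
  BTemp.isoOfEquiv (R.exists_glueEquiv b w h).choose (R.exists_glueEquiv b w h).choose_spec.1

/-- The chosen gluing lies over the gluing of the base. [cite: MochizukiSemiAnbd2006, Cor 2.7 p.30] -/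
theorem glue_fst (p : (S₀.SE (𝒢.graph.edgeOf b)).obj.V × R.D.XE (𝒢.graph.edgeOf b)) :
    Sum.elim (fun q => q.1.1) (fun q => q.1.1)
        ((R.glue b w h).hom.hom.hom p : R.VTy w) = (S₀.glue b w h).hom.hom.hom p.1 :=
  (R.exists_glueEquiv b w h).choose_spec.2 p

end Glue

/-- **The relatively glued covering** over `S₀` (a covering of `G'`, seen in `B^cov(G)`).
[cite: MochizukiSemiAnbd2006, Cor 2.7 p.30] -/
noncomputable def cov : CovObj 𝒢 where
  SV w := R.objV w
  SE e := R.objE e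
  glue b w h := R.glue b w h

end RelGluingData

end Approximator

end ProfiniteSemiGraph

end Literature.AnabelianGeometry.SemiGraphs
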